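import Literature.Topology.FourManifolds.Gluing
import Literature.Topology.FourManifolds.ClosedBall
import Literature.Topology.FourManifolds.Handles
import Literature.Topology.FourManifolds.MazurDouble
import Literature.Topology.FourManifolds.MazurDoubleHolds
import Literature.Geometry.Symplectic.SteinDomain
import Literature.Geometry.Symplectic.PlanarContactBoundary
import Summits.SmoothPoincare4.SmoothPoincare4.Theorems.ConvexBisectionPlanarAcyclicBisectionRigidityHelperDoubleBall
import HarnessLib
import Literature.Geometry.Symplectic.PlanarHomologySphereFillings

/-!
# Crux `ConvexBisection.PlanarAcyclicBisectionRigidity`, line Sketch — helper `helper_obaMazur_double_standard`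

Item stmt-SmoothPoincare4-15086 (route `route-SmoothPoincare4-ConvexBisection`), skeleton
`Cruxes/PlanarAcyclicBisectionRigidity/Lines/Sketch.lean` v2.2 (lead c2).  The `k ≤ 4` layer of the
line exits with an HONEST DOUBLE at level `3`: `M ≅ D(X)` for a compact contractible Stein domain `X`
whose boundary contact structure is supported by a planar open book with FOUR binding components
(page `Σ_{0,4}`).  By Oba's theorem (named fact below, Oba 2016 Thm. 1.1) such an `X` is `D⁴` or of
Mazur type; the double of `D⁴` is `S⁴` (landed `helper_double_closedBall_sphere`, p137754) and the
double of a Mazur-type manifold is `S⁴` by the tree's PROVED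
`Literature.Topology.FourManifolds.Mazur1961_double_sphere_four_holds`.  So these exits need no open
problem (crux 4 `ContractibleTwistedDoubleStandard` leaves the `k ≤ 4` path).

Contents: the named fact `Oba2016_steinFilling_fourHoledSphere` (stated inline with its cite tag
for relocation to `Literature/Geometry/Symplectic/`), and the registered helper
`helper_obaMazur_double_standard` (the fact as an explicit hypothesis; sorry-free).
-/

noncomputable section

-- the prescribed namespace `Summit.<S>.<P>.…` repeats `SmoothPoincare4` (S = P = SmoothPoincare4)
set_option linter.dupNamespace false

namespace Summit.SmoothPoincare4.SmoothPoincare4.Theorems.PlanarAcyclicBisectionRigidity.Sketch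

-- `_root_`-qualified on purpose: the gate relocates the cited fact below into
-- `namespace Literature.Geometry.Symplectic`, copying these `open`s; there the bare names `Manifold`,
-- `ContDiff`, `Topology` could resolve to nested namespaces and leave the scoped notations
-- `𝓡∂`, `𝓡`, `≃ₘ⟮_,_⟯`, `∞` closed (cf. CONVENTIONS §2; `…StubHandlebodyExtension.lean`).
open scoped _root_.Manifold _root_.ContDiff _root_.Topology
open _root_.Set _root_.Function _root_.Literature.Topology.FourManifolds _root_.Literature.Geometry.Symplectic

/-- **Oba + Mazur: the double of a contractible compact Stein domain whose boundary contact
structure is supported by a planar open book with four binding components is `S⁴`** (granted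
Oba's theorem `hO`).  By `hO` the domain is `D⁴` — then the landed
`helper_double_closedBall_sphere` (the double of a `4`-ball along any boundary datum is `S⁴`) —
or of Mazur type — then the tree's proved `Mazur1961_double_sphere_four_holds`.  This closes every
level-`3` honest double of the line's walk without the open crux `ContractibleTwistedDoubleStandard`.
[cite: Oba2016, Thm. 1.1] -/
theorem helper_obaMazur_double_standard
    (hO : Literature.Geometry.Symplectic.Oba2016_steinFilling_fourHoledSphere)
    (W : Type) [TopologicalSpace W] [T2Space W] [SecondCountableTopology W]
    [ChartedSpace (EuclideanHalfSpace 4) W] [IsManifold (𝓡∂ 4) ∞ W] [CompactSpace W]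
    [ContractibleSpace W] (S : SteinStructure W) (b : BoundaryData (𝓡∂ 4) W (𝓡 3))
    (ob : OpenBook b.carrier) (hpl : ob.IsPlanar) (hk : ob.k = 4)
    (hsupp : ob.Supports (boundaryPlaneField S.J b))
    (P : Type) [TopologicalSpace P] [T2Space P] [SecondCountableTopology P]
    [ChartedSpace (EuclideanSpace ℝ (Fin 4)) P] [IsManifold (𝓡 4) ∞ P] (hD : IsDouble b (𝓡 4) P) :
    Nonempty (P ≃ₘ⟮𝓡 4, 𝓡 4⟯ Metric.sphere (0 : EuclideanSpace ℝ (Fin 5)) 1) := by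
  have h := hO W S ⟨b, ob, hpl, hk, hsupp⟩
  rcases h with hball | hMazur
  · obtain ⟨e⟩ := hball
    exact helper_double_closedBall_sphere W e b P hD
  · exact Mazur1961_double_sphere_four_holds W hMazur b P hD

end Summit.SmoothPoincare4.SmoothPoincare4.Theorems.PlanarAcyclicBisectionRigidity.Sketch

end
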